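import Literature.NumberTheory.GelbartRogawski1991.FiniteAdelicSplittingAssembly
import Literature.NumberTheory.GelbartRogawski1991.LocalUnitarySplittingDatum
import Literature.NumberTheory.GelbartRogawski1991.LocalLeraySection
import Literature.RepresentationTheory.SeesawScalarCharacter
import HarnessLib

/-!
# Two local splittings of `U(J)(F_v)` into `S̃p_{ψ_v}(𝕎_v)` differ by a character with open kernel

Topic `NumberTheory/GelbartRogawski1991`; KERNEL ONLY (theorems; no definition, no named fact, no `sorry`).  The LOCAL,
finite-place form of [GelbartRogawski1991, §3.1, Remark p. 457 L4–13] («If `s*` is any other compatible splitting, then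
`s* = s ⊗ ν′` where `ν′` is a character with values in the central subgroup `ℂ*`»; the global/adelic form is the tree's
`SplittingDatum.IsCompatible.exists_central_twist` / `CompatibleSplittingTwist.lean`), for the tree's objects of
`LocalUnitarySplittingDatum.lean` / `FiniteAdelicSplittingAssembly.lean`:

* §1 (generic, namespace `Literature.RepresentationTheory.HeisenbergGroup`): for ANY model `ρ` of a Heisenberg group with
  implementers unique up to scalars (`ImplementerUniqueUpToScalar ρ`, [MoeglinVignerasWaldspurger1987, Chap. 2 II.1
  (A)]) on a space `S ≠ 0`, two homomorphisms `s, s' : G →* S̃p_ψ = MpPsi ρ` with the same projection to `Sp(W)` differ by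
  a CHARACTER `η : G →* kˣ` through the centre `i : kˣ → S̃p_ψ` — `s'(g) = i(η g) · s(g)`
  (`MpPsi.exists_character_of_proj_eq`; the exactness `ker p = im i` of [MVW, Chap. 2 II.1 (B)] is the tree's
  `MpPsi.mem_range_ofScalar_of_proj_eq_one`, the scalars multiply because `i(kˣ)` is central and `i` is injective) —
  so the pulled-back Weil representations are CHARACTER TWISTS of each other:
  `toRep ∘ s' = η • (toRep ∘ s)` (`MpPsi.exists_twist_toRep_comp_of_proj_eq`, in the currency `SeesawScalar.twist`).
* §2 at a finite place `v` of `F` (`E/F` quadratic, `J = T ⊗ 1`, `det T ≠ 0`): for two restricted families of local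
  splittings `𝓢, 𝓢' : FinLocalSplittings …` the local Weil representations satisfy
  `𝓢'.omegaLoc v = η_v • 𝓢.omegaLoc v` for a character `η_v` of `U(J)(F_v)` whose KERNEL IS OPEN
  (`FinLocalSplittings.exists_twist_omegaLoc`): both `ω_v`'s are smooth, so on the common open stabiliser of one
  non-zero Schwartz–Bruhat function `η_v = 1`.  The same for two local splitting DATA `D, D'` of
  `LocalUnitarySplittingDatum.lean` (any Haar measures, any Lagrangians): `LocalSplittingDatum.exists_twist_localOmega`.

Use: the as-printed record [Liu2021, App. D Lem. D.1 (1)] is read by the Hodge/COR-CM cell at a datum whose carrier is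
`𝓢.omegaLoc v` for ONE family `𝓢`; with `Liu2021/LemD1AsPrintedTwist.lean` (`LemD1_1AsPrinted.twist_iff`: the record is
invariant under open-kernel character twists unitary on the centre, rank `≠ 2`) the present file shows that reading does
not depend on the normalisation of the local splittings.  Nothing of [GelbartRogawski1991] or [Liu2021] is asserted.

## References
* [GelbartRogawski1991] S. Gelbart, J. Rogawski, *L-functions and Fourier–Jacobi coefficients for the unitary group
  U(3)*, Invent. Math. 105 (1991), §3.1 Prop. 3.1.1 p. 455 and Remark p. 457 L4–13.
* [MoeglinVignerasWaldspurger1987] C. Mœglin, M.-F. Vignéras, J.-L. Waldspurger, *Correspondances de Howe sur un corps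
  p-adique*, LNM 1291 (1987), Chap. 2 II.1 (A)–(B) (implementers unique up to scalars; the extension `S̃p_ψ(W)`),
  II.8 (smoothness).
-/

set_option autoImplicit false

noncomputable section

/-! ## §1 Two lifts of one homomorphism to `S̃p_ψ` differ by a character through the centre -/

namespace Literature.RepresentationTheory.HeisenbergGroup

open Literature.RepresentationTheory (SeesawScalar.twist SeesawScalar.twist_apply)

universe u v u' v' w

section General

variable {R : Type u} [CommRing R] [Invertible (2 : R)] {V : Type v} [AddCommGroup V] [Module R V]
  {B : V →ₗ[R] V →ₗ[R] R}
variable {k : Type u'} [Field k] {S : Type v'} [AddCommGroup S] [Module k S]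
variable (ρ : Representation k (Heisenberg B) S) {G : Type w} [Group G]

/-- Two elements of `S̃p_ψ` over the same element of `Sp(W)` differ by a central scalar: if `p(s' g) = p(s g)` then
`s' g = i(c) · s(g)` for some `c ∈ kˣ` (exactness `ker p = im i` of MVW II.1 (B), from uniqueness of implementers up to
scalars). [cite: MoeglinVignerasWaldspurger1987, Chap. 2 II.1 (B)] -/
theorem MpPsi.exists_ofScalar_mul_eq_of_proj_eq (hU : ImplementerUniqueUpToScalar ρ) (s s' : G →* MpPsi ρ)
    (h : ∀ g, MpPsi.proj ρ (s' g) = MpPsi.proj ρ (s g)) (g : G) :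
    ∃ c : kˣ, s' g = MpPsi.ofScalar ρ c * s g := by
  have hx : MpPsi.proj ρ ((s g)⁻¹ * s' g) = 1 := by rw [map_mul, map_inv, h g, inv_mul_cancel]
  obtain ⟨c, hc⟩ := MpPsi.mem_range_ofScalar_of_proj_eq_one ρ hU _ hx
  refine ⟨c, ?_⟩
  have hz : s g * MpPsi.ofScalar ρ c = MpPsi.ofScalar ρ c * s g :=
    Subgroup.mem_center_iff.1 (MpPsi.ofScalar_mem_center ρ c) (s g)
  rw [← hz, hc, mul_inv_cancel_left]

variable [Nontrivial S]

/-- **Two homomorphisms `s, s' : G →* S̃p_ψ` with the same projection to `Sp(W)` differ by a CHARACTER through the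
centre**: `s'(g) = i(η g) · s(g)` for a (unique) `η : G →* kˣ` — the scalars of `exists_ofScalar_mul_eq_of_proj_eq`
multiply because `i(kˣ)` is central and `i` is injective (`S ≠ 0`).  Local form of «any other splitting is `s ⊗ ν′`,
`ν′` a character with values in the central `ℂ*`». [cite: GelbartRogawski1991, §3.1 Remark p. 457 L4–13]
[cite: MoeglinVignerasWaldspurger1987, Chap. 2 II.1 (B)] -/
theorem MpPsi.exists_character_of_proj_eq (hU : ImplementerUniqueUpToScalar ρ) (s s' : G →* MpPsi ρ)
    (h : ∀ g, MpPsi.proj ρ (s' g) = MpPsi.proj ρ (s g)) :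
    ∃ η : G →* kˣ, ∀ g, s' g = MpPsi.ofScalar ρ (η g) * s g := by
  choose c hc using MpPsi.exists_ofScalar_mul_eq_of_proj_eq ρ hU s s' h
  have hinj : Function.Injective (MpPsi.ofScalar ρ) := MpPsi.ofScalar_injective ρ
  have hone : c 1 = 1 := by
    apply hinj
    have e1 := hc 1
    rw [map_one, map_one, mul_one] at e1
    rw [map_one]
    exact e1.symm
  have hmul : ∀ a b, c (a * b) = c a * c b := by
    intro a b
    apply hinj
    have hz : s a * MpPsi.ofScalar ρ (c b) = MpPsi.ofScalar ρ (c b) * s a :=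
      Subgroup.mem_center_iff.1 (MpPsi.ofScalar_mem_center ρ (c b)) (s a)
    have e1 : s' (a * b) = MpPsi.ofScalar ρ (c (a * b)) * s (a * b) := hc (a * b)
    have e2 : s' (a * b) = MpPsi.ofScalar ρ (c a) * MpPsi.ofScalar ρ (c b) * s (a * b) := by
      rw [map_mul s', hc a, hc b, map_mul s]
      calc MpPsi.ofScalar ρ (c a) * s a * (MpPsi.ofScalar ρ (c b) * s b)
          = MpPsi.ofScalar ρ (c a) * (s a * MpPsi.ofScalar ρ (c b)) * s b := by
            rw [mul_assoc, ← mul_assoc (s a), ← mul_assoc]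
        _ = MpPsi.ofScalar ρ (c a) * MpPsi.ofScalar ρ (c b) * (s a * s b) := by
            rw [hz, ← mul_assoc, mul_assoc]
    rw [map_mul]
    exact mul_right_cancel (e1.symm.trans e2)
  exact ⟨⟨⟨c, hone⟩, hmul⟩, hc⟩

/-- **Hence the two pulled-back Weil representations are character twists of each other**: with `η` as above,
`(toRep ∘ s')(g) f = η(g) • (toRep ∘ s)(g) f`, i.e. `toRep ∘ s' = η • (toRep ∘ s)` (`SeesawScalar.twist`).
[cite: GelbartRogawski1991, §3.1 Remark p. 457 L4–13] [cite: MoeglinVignerasWaldspurger1987, Chap. 2 II.1] -/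
theorem MpPsi.exists_twist_toRep_comp_of_proj_eq (hU : ImplementerUniqueUpToScalar ρ) (s s' : G →* MpPsi ρ)
    (h : ∀ g, MpPsi.proj ρ (s' g) = MpPsi.proj ρ (s g)) :
    ∃ η : G →* kˣ, (MpPsi.toRep ρ).comp s' = SeesawScalar.twist η ((MpPsi.toRep ρ).comp s) := by
  obtain ⟨η, hη⟩ := MpPsi.exists_character_of_proj_eq ρ hU s s' h
  refine ⟨η, MonoidHom.ext fun g => LinearMap.ext fun f => ?_⟩
  rw [SeesawScalar.twist_apply, MonoidHom.comp_apply, MonoidHom.comp_apply, MpPsi.toRep_apply, MpPsi.toRep_apply,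
    hη g, Subgroup.coe_mul, Prod.snd_mul, LinearEquiv.mul_apply, MpPsi.coe_ofScalar, scalarOp_apply]

/-- … and the character is UNIQUE (`S ≠ 0`): if `s'(g) = i(c₁) · s(g) = i(c₂) · s(g)` then `c₁ = c₂` (`i` is injective).
[cite: MoeglinVignerasWaldspurger1987, Chap. 2 II.1 (B)] -/
theorem MpPsi.ofScalar_mul_eq_unique (s s' : G →* MpPsi ρ) {g : G} {c₁ c₂ : kˣ}
    (h₁ : s' g = MpPsi.ofScalar ρ c₁ * s g) (h₂ : s' g = MpPsi.ofScalar ρ c₂ * s g) : c₁ = c₂ :=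
  MpPsi.ofScalar_injective ρ (mul_right_cancel (h₁.symm.trans h₂))

/-- hence the character `η` of `exists_character_of_proj_eq` is unique: two characters `η₁, η₂` with
`s'(g) = i(η_j g) · s(g)` for all `g` coincide. [cite: GelbartRogawski1991, §3.1 Remark p. 457 L4–13] -/
theorem MpPsi.character_of_proj_eq_unique (s s' : G →* MpPsi ρ) {η₁ η₂ : G →* kˣ}
    (h₁ : ∀ g, s' g = MpPsi.ofScalar ρ (η₁ g) * s g) (h₂ : ∀ g, s' g = MpPsi.ofScalar ρ (η₂ g) * s g) : η₁ = η₂ :=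
  MonoidHom.ext fun g => MpPsi.ofScalar_mul_eq_unique ρ s s' (h₁ g) (h₂ g)

end General

end Literature.RepresentationTheory.HeisenbergGroup

/-! ## §2 At a finite place: two local splittings of `U(J)(F_v)` give Weil representations differing by an
open-kernel character -/

namespace Literature.NumberTheory.GelbartRogawski1991.UnitaryDualPair.LocalSplitting

open NumberField IsDedekindDomain
open Literature.RepresentationTheory (SeesawScalar.twist SeesawScalar.twist_apply)
open Literature.RepresentationTheory.HeisenbergGroup
open Literature.NumberTheory.Automorphic

variable {F : Type} [Field F] [NumberField F] {E : Type} [Field E] [NumberField E] [Algebra F E]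
  [Algebra.IsQuadraticExtension F E] {c : E ≃ₐ[F] E} {N : ℕ} {δ : E} {hcδ : c δ = -δ} {hδ : δ ≠ 0} {d : F}
  {hd : δ * δ = algebraMap F E d} {T : Matrix (Fin N) (Fin N) F} {hT : T.IsSymm}
  {J : Matrix (Fin N) (Fin N) E} {hJ : J = T.map (algebraMap F E)}

/-- The kernel of a character comparing two SMOOTH actions on one non-zero vector is open: if `ρ' g Φ = η(g) • ρ g Φ`
for all `g`, `Φ ≠ 0`, and the stabilisers of `Φ` under `ρ` and `ρ'` are open, then `ker η ⊇ Stab_ρ(Φ) ∩ Stab_{ρ'}(Φ)` is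
open. [cite: MoeglinVignerasWaldspurger1987, Chap. 2 II.8] -/
theorem isOpen_ker_of_twist_of_isSmoothVector {G S : Type*} [Group G] [TopologicalSpace G] [ContinuousMul G]
    [AddCommGroup S] [Module ℂ S] (ρ ρ' : Representation ℂ G S) (η : G →* ℂˣ)
    (hη : ∀ g f, ρ' g f = ((η g : ℂˣ) : ℂ) • ρ g f) {Φ : S} (hΦ : Φ ≠ 0) (h : ρ.IsSmoothVector Φ)
    (h' : ρ'.IsSmoothVector Φ) : IsOpen ((η.ker : Subgroup G) : Set G) := by
  have hle : ρ.stabilizerSubgroup Φ ⊓ ρ'.stabilizerSubgroup Φ ≤ η.ker := by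
    intro g hg
    obtain ⟨h1, h2⟩ := Subgroup.mem_inf.1 hg
    rw [Representation.mem_stabilizerSubgroup] at h1 h2
    rw [MonoidHom.mem_ker]
    rw [hη g Φ, h1] at h2
    have h3 : ((η g : ℂˣ) : ℂ) • Φ = (1 : ℂ) • Φ := by rw [h2, one_smul]
    exact Units.val_eq_one.1 (smul_left_injective ℂ hΦ h3)
  refine Subgroup.isOpen_mono hle ?_
  rw [Subgroup.coe_inf]
  exact h.inter h'

/-- **Two restricted families of local splittings give, at each finite place, local Weil representations that differ
by a character of `U(J)(F_v)` with OPEN kernel**: `𝓢'.omegaLoc v = η_v • 𝓢.omegaLoc v`.  The character comes from §1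
(both `s_v`, `s'_v` lie over `ι_v`, implementers of the local Schrödinger model are unique up to scalars —
`implementerUniqueUpToScalar_localSchrodinger`, `det T ≠ 0`); its kernel is open because both `ω_v`'s are smooth
(`isSmooth_omegaLoc`) and `𝒮(F_vᴺ) ≠ 0`. [cite: GelbartRogawski1991, §3.1 Remark p. 457 L4–13]
[cite: MoeglinVignerasWaldspurger1987, Chap. 2 II.1, II.8] -/
theorem FinLocalSplittings.exists_twist_omegaLoc (hTd : IsUnit T.det)
    (𝓢 𝓢' : FinLocalSplittings F E c N hcδ hδ hd T hT hJ) (v : HeightOneSpectrum (𝓞 F)) :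
    ∃ η : UnitaryGroup.localPi E c N J v →* ℂˣ,
      IsOpen ((η.ker : Subgroup (UnitaryGroup.localPi E c N J v)) : Set (UnitaryGroup.localPi E c N J v)) ∧
        𝓢'.omegaLoc v = SeesawScalar.twist η (𝓢.omegaLoc v) := by
  haveI : Nontrivial (SchwartzBruhat (Fin N → v.adicCompletion F)) := nontrivial_schwartzBruhat_pi
  obtain ⟨η, hη⟩ := MpPsi.exists_twist_toRep_comp_of_proj_eq (localSchrodinger F N T v)
    (implementerUniqueUpToScalar_localSchrodinger F N T hTd v) (𝓢.s v) (𝓢'.s v)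
    (fun g => by rw [𝓢.proj_s, 𝓢'.proj_s])
  have hη' : 𝓢'.omegaLoc v = SeesawScalar.twist η (𝓢.omegaLoc v) := hη
  obtain ⟨Φ₀, hΦ₀⟩ := exists_ne (0 : SchwartzBruhat (Fin N → v.adicCompletion F))
  refine ⟨η, isOpen_ker_of_twist_of_isSmoothVector (𝓢.omegaLoc v) (𝓢'.omegaLoc v) η
    (fun g f => by rw [hη', SeesawScalar.twist_apply]) hΦ₀ (𝓢.isSmooth_omegaLoc v Φ₀) (𝓢'.isSmooth_omegaLoc v Φ₀), hη'⟩

/-- **Two local splitting DATA at `v` (any Haar measures, any Lagrangians) give local Weil representations that differ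
by a character of `U(J)(F_v)` with OPEN kernel**: `D'.localOmega = η • D.localOmega` — §1 over `ι_v`
(`proj_localSplitting`), the kernel open by the smoothness fields of the two data.
[cite: GelbartRogawski1991, §3.1 Remark p. 457 L4–13] [cite: Kudla1994, Thm 3.1] -/
theorem LocalSplittingDatum.exists_twist_localOmega {hTd : IsUnit T.det} {v : HeightOneSpectrum (𝓞 F)}
    [MeasurableSpace (v.adicCompletion F)] [BorelSpace (v.adicCompletion F)]
    {μ : MeasureTheory.Measure (v.adicCompletion F)} [μ.IsAddHaarMeasure]
    {μ' : MeasureTheory.Measure (v.adicCompletion F)} [μ'.IsAddHaarMeasure]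
    {ℓ : Submodule (v.adicCompletion F) ((Fin N → v.adicCompletion F) × (Fin N → v.adicCompletion F))}
    {hℓ : LinearMap.BilinForm.orthogonal (alt (polar (localPairing F N T v))) ℓ = ℓ}
    {ℓ' : Submodule (v.adicCompletion F) ((Fin N → v.adicCompletion F) × (Fin N → v.adicCompletion F))}
    {hℓ' : LinearMap.BilinForm.orthogonal (alt (polar (localPairing F N T v))) ℓ' = ℓ'}
    (D : LocalSplittingDatum F E c N hcδ hδ hd T hT hTd hJ v μ ℓ hℓ)
    (D' : LocalSplittingDatum F E c N hcδ hδ hd T hT hTd hJ v μ' ℓ' hℓ') :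
    ∃ η : UnitaryGroup.localPi E c N J v →* ℂˣ,
      IsOpen ((η.ker : Subgroup (UnitaryGroup.localPi E c N J v)) : Set (UnitaryGroup.localPi E c N J v)) ∧
        D'.localOmega = SeesawScalar.twist η D.localOmega := by
  haveI : Nontrivial (SchwartzBruhat (Fin N → v.adicCompletion F)) := nontrivial_schwartzBruhat_pi
  obtain ⟨η, hη⟩ := MpPsi.exists_twist_toRep_comp_of_proj_eq (localSchrodinger F N T v) D.hU
    D.localSplitting D'.localSplitting (fun g => by rw [D.proj_localSplitting, D'.proj_localSplitting])
  have hη' : D'.localOmega = SeesawScalar.twist η D.localOmega := hη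
  obtain ⟨Φ₀, hΦ₀⟩ := exists_ne (0 : SchwartzBruhat (Fin N → v.adicCompletion F))
  -- the smoothness fields of the two data: `ω(k) Φ₀ = Φ₀` on open subgroups
  have hsm : D.localOmega.IsSmoothVector Φ₀ := by
    obtain ⟨U, hU, hfix⟩ := D.smooth Φ₀
    rw [Representation.isSmoothVector_iff]
    exact Subgroup.isOpen_mono (fun k hk => (D.localOmega.mem_stabilizerSubgroup Φ₀ k).2 (hfix k hk)) hU
  have hsm' : D'.localOmega.IsSmoothVector Φ₀ := by
    obtain ⟨U, hU, hfix⟩ := D'.smooth Φ₀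
    rw [Representation.isSmoothVector_iff]
    exact Subgroup.isOpen_mono (fun k hk => (D'.localOmega.mem_stabilizerSubgroup Φ₀ k).2 (hfix k hk)) hU
  exact ⟨η, isOpen_ker_of_twist_of_isSmoothVector D.localOmega D'.localOmega η
    (fun g f => by rw [hη', SeesawScalar.twist_apply]) hΦ₀ hsm hsm', hη'⟩

end Literature.NumberTheory.GelbartRogawski1991.UnitaryDualPair.LocalSplitting

end
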